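import Summits.FinalStateConjecture.FinalStateConjecture.Theorems.BondiDrainDispersalHorizonlessMustDrainLogicTier
import HarnessLib

/-!
# Route BondiDrainDispersal · crux `HorizonlessMustDrain` (stmt-FinalStateConjecture-9976):
# the SECTOR SPLIT glue `CompleteSector → IncompleteSector → HorizonlessMustDrain`

Crux-strategist (family `s`, seat s2, 2026-08-17), output (b) DECOMPOSITION.  The crux
"censored + horizonless MGHD of an admissible vacuum datum ⇒ vanishing final Bondi mass" splits BY PURE
LOGIC at future causal geodesic completeness of the development (lead c3's
`horizonlessMustDrain_iff_sectors`, p157550) into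

* `CompleteSector` — every future causally geodesically complete MGHD of an admissible datum has
  vanishing final Bondi mass (the no-soliton theorem at `𝓘⁺`; the censorship and no-horizon hypotheses of
  the crux are idle there by W3 `stub_noHorizon_of_futureNullComplete` p156437 and W6
  `stub_scriComplete_of_futureNullComplete` p156711);
* `IncompleteSector` — a censored, horizonless but future causally geodesically INCOMPLETE MGHD of an
  admissible datum has vanishing final Bondi mass (conjecturally vacuous: stub C of line `birth`,
  `incompleteSector_of_C`).

This file lands the curried assembly `HorizonlessMustDrain_of_subs : CompleteSector → IncompleteSector →
HorizonlessMustDrain` (hypotheses = the two sector statements verbatim, in the form the LogicTier file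
states them; conclusion = the route decl BY NAME), the `--glue-by` theorem of
`ledger route edit route-FinalStateConjecture-BondiDrainDispersal --split HorizonlessMustDrain --into CompleteSector IncompleteSector`.
No definition, no named fact, no sorry.  [folklore]
-/

set_option linter.dupNamespace false

noncomputable section

open scoped Manifold ContDiff Topology
open Set Function Literature.Geometry.Lorentzian

namespace Summit.FinalStateConjecture.FinalStateConjecture.Theorems.BondiDrainDispersalHorizonlessMustDrain

open Summit.FinalStateConjecture.FinalStateConjecture.Theses.BondiDrainDispersal (HorizonlessMustDrain)

/-- **Sector split of the crux, assembly direction** (`--glue-by` theorem): the complete sector and the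
incomplete sector together give `HorizonlessMustDrain`.  One line from `horizonlessMustDrain_iff_sectors`.
[folklore] -/
theorem HorizonlessMustDrain_of_subs :
    (∀ (X : Type) [TopologicalSpace X] [ChartedSpace E3 X] [IsManifold (𝓡 3) ∞ X] [T2Space X]
      [SecondCountableTopology X] [ConnectedSpace X],
      ∀ D ∈ admissibleVacuumData X, ∀ 𝒟 : VacuumCauchyDevelopment D, 𝒟.IsMaximal →
        (∀ [𝒟.metric.HasLeviCivita], ¬ 𝒟.metric.IsFutureNullGeodesicallyIncomplete 𝒟.timeOrientation ∧
          ¬ 𝒟.metric.IsFutureTimelikeGeodesicallyIncomplete 𝒟.timeOrientation) →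
        𝒟.toCauchyDevelopment.HasVanishingFinalBondiMass) →
    (∀ (X : Type) [TopologicalSpace X] [ChartedSpace E3 X] [IsManifold (𝓡 3) ∞ X] [T2Space X]
      [SecondCountableTopology X] [ConnectedSpace X],
      ∀ D ∈ admissibleVacuumData X, ∀ 𝒟 : VacuumCauchyDevelopment D, 𝒟.IsMaximal →
        Summit.FinalStateConjecture.HasCompleteNullInfinity 𝒟.toCauchyDevelopment →
        ¬ (∀ [𝒟.metric.HasLeviCivita], ∃ q : 𝒟.carrier, ∀ (p : X) (γ : ℝ → 𝒟.carrier) (dom : Set ℝ),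
            𝒟.metric.IsNormalisedNullRayFrom 𝒟.timeOrientation 𝒟.embed 𝒟.normal p γ dom → ¬ BddAbove dom →
              q ∉ 𝒟.metric.chronologicalPast 𝒟.timeOrientation (γ '' (dom ∩ Set.Ici 0))) →
        ¬ (∀ [𝒟.metric.HasLeviCivita], ¬ 𝒟.metric.IsFutureNullGeodesicallyIncomplete 𝒟.timeOrientation ∧
            ¬ 𝒟.metric.IsFutureTimelikeGeodesicallyIncomplete 𝒟.timeOrientation) →
        𝒟.toCauchyDevelopment.HasVanishingFinalBondiMass) →
    HorizonlessMustDrain :=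
  fun hC hI ↦ horizonlessMustDrain_iff_sectors.2 ⟨hC, hI⟩

/-! Audit: the assembly concludes the route decl by name, with exactly two hypotheses (the split is exact:
`horizonlessMustDrain_iff_sectors`). -/
example := (HorizonlessMustDrain_of_subs :
  _ → _ → Summit.FinalStateConjecture.FinalStateConjecture.Theses.BondiDrainDispersal.HorizonlessMustDrain)

end Summit.FinalStateConjecture.FinalStateConjecture.Theorems.BondiDrainDispersalHorizonlessMustDrain

end
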